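import Literature.Analysis.FluidPDE.JetTimeDerivativeEstimates
import Literature.Analysis.FluidPDE.AntidivergenceDerivLp
import HarnessLib

/-!
# The intermittent-jet perturbation: the term `ℛ ∂ₜ(w^{(p)} + w^{(c)})` (BV §7.6.2 (7.49))

Analysis/FluidPDE support file (everything proved): the bound of `∫‖ℛ f₁‖`, `f₁ = ∂ₜ wpc`, for
the perturbation of `JetPerturbation`. Since `wpc = ∑_x div (a Ω_x)` with the skew tensors
`Ω_x = η_x (∂ⱼφ̃ k - kⱼ∇φ̃)` (`JetPerturbation`, BV (7.35)–(7.36)), `f₁ = ∑_x div ∂ₜ(a Ω_x)` and the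
order-zero bound `‖ℛ div A‖_{L^p} ≤ C ∑ₘ ‖A eₘ‖_{L^p}` (`AntidivergenceDerivLp`, `1 < p < ∞`)
reduces the estimate to the `L^p` sizes of the columns `∂ₜ(a Ω_x) eₘ = (ȧη + aωη′)(∂ₘφ̃ k - kₘ∇φ̃)`,
controlled by the blocks `η∂ₗφ̃`, `η′∂ₗφ̃` of `Jet.Bounds` (their `L^p` sizes for `1 ≤ p ≤ 2`);
this is (7.49) of Buckmaster–Vicol, EMS Surv. Math. Sci. 6 (2019), §7.6.2, with the gain
`μ′ κ^{1/2} μ^{-2}` at `p → 1`.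

## References

* T. Buckmaster, V. Vicol, EMS Surv. Math. Sci. 6 (2019) = arXiv:1901.09023, §7.6.2 (7.49). [`BuckmasterVicol2020`]
-/

noncomputable section

open MeasureTheory Set Filter Topology Function
open scoped InnerProductSpace ContDiff ENNReal NNReal

namespace Literature.Analysis.FluidPDE

namespace JetStep

open Literature.Analysis.FunctionSpaces FunctionSpaces.Torus Mikado NashGeometric Jet

local notation "𝕋³" => UnitAddTorus (Fin 3)
local notation "E³" => EuclideanSpace ℝ (Fin 3)
local notation "Idx" => Index (Fin 3)

namespace Datum

variable {D : Datum} (h : D.Valid) {A₀ A₁ A₂ H₁ H₂ B : ℝ} (hA : D.AmpBounds A₀ A₁ A₂ H₁ H₂)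
  (hB : ∀ x t, Jet.Bounds B (D.J x) D.s x t) (hB1 : 1 ≤ B)

/-- The time derivative of the skew tensor `a Ω_x` (whole tensor). [folklore] -/
def Adot (D : Datum) (x : Idx) (t : ℝ) : 𝕋³ → Fin 3 → E³ :=
  Torus.timeDerivWithin (Icc 0 D.T) (fun s z j => D.a x s z • Jet.Om (D.J x) D.s x s z j) t

include h

/-- Smoothness of `Adot`. [folklore] -/
theorem isSmooth_Adot (x : Idx) {t : ℝ} (ht : t ∈ Icc 0 D.T) : Torus.IsSmooth (D.Adot x t) :=
  (smooth_aOm h x).isSmooth_timeDerivWithin (uniqueDiffOn h) ht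

/-- **The columns of `Adot`**: `∂ₜ(aΩ) eₘ = (ȧ η + a ω η′) • (∂ₘφ̃ k - kₘ∇φ̃)`. [folklore] -/
theorem Adot_apply (x : Idx) {t : ℝ} (ht : t ∈ Icc 0 D.T) (z : 𝕋³) (m : Fin 3) :
    D.Adot x t z m = (D.adot x t z * Jet.eta (D.J x) x t z + D.a x t z * ((D.J x).om * Jet.etaD (D.J x) x t z)) • Jet.frame (D.J x) D.s x z m := by
  have hU := uniqueDiffOn h
  have hJ := Jvalid h x
  have e1 : D.Adot x t z m = Torus.timeDerivWithin (Icc 0 D.T) (fun s z' => D.a x s z' • Jet.Om (D.J x) D.s x s z' m) t z := by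
    unfold Datum.Adot
    exact (Torus.timeDerivWithin_clm_comp (smooth_aOm h x) hU (ContinuousLinearMap.proj m) ht z).symm
  rw [e1]
  have ha : HasDerivWithinAt (fun s => D.a x s z) (D.adot x t z) (Icc 0 D.T) t := (smooth_a h x).hasDerivWithinAt_slice ht z
  have hη : HasDerivWithinAt (fun s => Jet.eta (D.J x) x s z) ((D.J x).om * Jet.etaD (D.J x) x t z) (Icc 0 D.T) t :=
    (Jet.hasDerivAt_eta hJ x z t).hasDerivWithinAt
  have key := (ha.mul hη).smul_const (Jet.frame (D.J x) D.s x z m)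
  have key' : HasDerivWithinAt (fun s => D.a x s z • Jet.Om (D.J x) D.s x s z m)
      ((D.adot x t z * Jet.eta (D.J x) x t z + D.a x t z * ((D.J x).om * Jet.etaD (D.J x) x t z)) • Jet.frame (D.J x) D.s x z m) (Icc 0 D.T) t := by
    refine key.congr (fun s _ => ?_) ?_
    · show D.a x s z • (Jet.eta (D.J x) x s z • Jet.frame (D.J x) D.s x z m) = _; rw [smul_smul]; rfl
    · show D.a x t z • (Jet.eta (D.J x) x t z • Jet.frame (D.J x) D.s x z m) = _; rw [smul_smul]; rfl
  exact key'.derivWithin (hU t ht)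

/-- **`f₁ = ∑_x div ∂ₜ(a Ω_x)`**. [cite: BuckmasterVicol2020, §7.6.2 (7.49)] -/
theorem f₁_eq_sum_tensorDivergence_Adot {t : ℝ} (ht : t ∈ Icc 0 D.T) (y : 𝕋³) :
    D.f₁ t y = ∑ x, Torus.tensorDivergence (D.Adot x t) y := by
  have hT := h.hT
  have hU := uniqueDiffOn h
  show Torus.timeDerivWithin (Icc 0 D.T) D.wpc t y = _
  have key : HasDerivWithinAt (fun s => D.wpc s y) (∑ x, Torus.tensorDivergence (D.Adot x t) y) (Icc 0 D.T) t := by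
    unfold Datum.wpc Torus.tensorDivergence
    refine HasDerivWithinAt.fun_sum fun x _ => HasDerivWithinAt.fun_sum fun j _ => ?_
    -- the column `j` of `a Ω_x` as a jointly smooth vector field
    have hcol : Torus.IsSmoothSpaceTimeOn (Icc 0 D.T) (fun s z => D.a x s z • Jet.Om (D.J x) D.s x s z j) :=
      (smooth_aOm h x).clm_comp (ContinuousLinearMap.proj j)
    have h1 := ((hcol.partialDeriv hU j).hasDerivWithinAt_slice ht y)
    have hc := Torus.timeDerivWithin_partialDeriv_comm hT hcol ht j y
    refine h1.congr_deriv ?_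
    rw [hc]
    congr 1
    funext z
    unfold Datum.Adot
    exact (Torus.timeDerivWithin_clm_comp (smooth_aOm h x) hU (ContinuousLinearMap.proj j) ht z)
  exact key.derivWithin (hU t ht)

include hA

/-- **Pointwise majorant of the columns of `Adot`**: `‖∂ₜ(aΩ)eₘ‖ ≤ ∑ₗ (6A₁|η∂ₗφ̃| + 30σμ′A₀|η′∂ₗφ̃|)`. [folklore] -/
theorem norm_Adot_apply_le (x : Idx) {t : ℝ} (ht : t ∈ Icc 0 D.T) (z : 𝕋³) (m : Fin 3) :
    ‖D.Adot x t z m‖ ≤ ∑ l, (6 * A₁ * |Jet.eta (D.J x) x t z * Torus.partialDeriv l (Jet.phiJ (D.J x) D.s x) z| +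
      30 * D.σ * D.mup * A₀ * |Jet.etaD (D.J x) x t z * Torus.partialDeriv l (Jet.phiJ (D.J x) D.s x) z|) := by
  rw [Adot_apply h x ht z m, norm_smul, Real.norm_eq_abs]
  have hA0 := hA.hA₀; have hA1 := hA.hA₁
  obtain ⟨hom0, hom⟩ := om_le h x
  have had : |D.adot x t z| ≤ A₁ := hA.dta_le x t ht z
  have ha0 := hA.a_le x t ht z
  have hφ := isSmooth_phiJ h x
  set Sφ := ∑ l, |Torus.partialDeriv l (Jet.phiJ (D.J x) D.s x) z| with hSφ
  have hS0 : 0 ≤ Sφ := Finset.sum_nonneg fun _ _ => abs_nonneg _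
  -- `‖frame‖ ≤ 6 Sφ`
  have hfr : ‖Jet.frame (D.J x) D.s x z m‖ ≤ 6 * Sφ := by
    unfold Jet.frame
    have hm : |Torus.partialDeriv m (Jet.phiJ (D.J x) D.s x) z| ≤ Sφ :=
      Finset.single_le_sum (f := fun l => |Torus.partialDeriv l (Jet.phiJ (D.J x) D.s x) z|) (fun _ _ => abs_nonneg _) (Finset.mem_univ m)
    have hg := norm_gradient_le (hφ.isContDiff (by simp)) z
    calc ‖Torus.partialDeriv m (Jet.phiJ (D.J x) D.s x) z • dirVec x - (((dir x m : ℤ) : ℝ)) • Torus.gradient (Jet.phiJ (D.J x) D.s x) z‖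
        ≤ ‖Torus.partialDeriv m (Jet.phiJ (D.J x) D.s x) z • dirVec x‖ + ‖(((dir x m : ℤ) : ℝ)) • Torus.gradient (Jet.phiJ (D.J x) D.s x) z‖ := norm_sub_le _ _
      _ ≤ Sφ * 3 + 3 * Sφ := by
          rw [norm_smul, norm_smul, Real.norm_eq_abs, Real.norm_eq_abs]
          exact add_le_add (mul_le_mul hm (CL22.norm_dirVec_le x) (norm_nonneg _) hS0) (mul_le_mul (abs_dir_le x m) hg (norm_nonneg _) (by norm_num))
      _ = 6 * Sφ := by ring
  have hsc : |D.adot x t z * Jet.eta (D.J x) x t z + D.a x t z * ((D.J x).om * Jet.etaD (D.J x) x t z)| ≤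
      A₁ * |Jet.eta (D.J x) x t z| + A₀ * (5 * D.σ * D.mup) * |Jet.etaD (D.J x) x t z| := by
    refine (abs_add_le _ _).trans (add_le_add ?_ ?_)
    · rw [abs_mul]; exact mul_le_mul_of_nonneg_right had (abs_nonneg _)
    · rw [abs_mul, abs_mul, abs_of_nonneg hom0]
      calc |D.a x t z| * ((D.J x).om * |Jet.etaD (D.J x) x t z|) ≤ A₀ * ((5 * D.σ * D.mup) * |Jet.etaD (D.J x) x t z|) :=
            mul_le_mul ha0 (mul_le_mul_of_nonneg_right hom (abs_nonneg _)) (by positivity) hA0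
        _ = _ := by ring
  calc |D.adot x t z * Jet.eta (D.J x) x t z + D.a x t z * ((D.J x).om * Jet.etaD (D.J x) x t z)| * ‖Jet.frame (D.J x) D.s x z m‖
      ≤ (A₁ * |Jet.eta (D.J x) x t z| + A₀ * (5 * D.σ * D.mup) * |Jet.etaD (D.J x) x t z|) * (6 * Sφ) :=
        mul_le_mul hsc hfr (norm_nonneg _) (by have := (pos h).2.2.1.le; have := (pos h).2.2.2.1.le; positivity)
    _ = 6 * A₁ * (|Jet.eta (D.J x) x t z| * Sφ) + 30 * D.σ * D.mup * A₀ * (|Jet.etaD (D.J x) x t z| * Sφ) := by ring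
    _ = ∑ l, (6 * A₁ * |Jet.eta (D.J x) x t z * Torus.partialDeriv l (Jet.phiJ (D.J x) D.s x) z| +
        30 * D.σ * D.mup * A₀ * |Jet.etaD (D.J x) x t z * Torus.partialDeriv l (Jet.phiJ (D.J x) D.s x) z|) := by
        rw [hSφ, Finset.mul_sum, Finset.mul_sum, Finset.mul_sum, Finset.mul_sum, ← Finset.sum_add_distrib]
        refine Finset.sum_congr rfl fun l _ => ?_
        rw [abs_mul, abs_mul]

/-- The `L^p` sizes of the blocks `η∂ₗφ̃`, `η′∂ₗφ̃` (from `Jet.Bounds`, `1 ≤ p ≤ 2`). [folklore] -/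
def Keta (D : Datum) (B p : ℝ) : ℝ :=
  ((((D.σ : ℝ))⁻¹) ^ p * ((D.κ ^ (1 / 2 : ℝ) * B) ^ (p - 1) * (D.κ ^ (-(1 / 2 : ℝ)) * B)) * (B * D.μ ^ (-(2 / p))) ^ p) ^ (1 / p)

/-- see `Keta`. [folklore] -/
def KetaD (D : Datum) (B p : ℝ) : ℝ :=
  ((((D.σ : ℝ))⁻¹) ^ p * ((D.κ ^ (3 / 2 : ℝ) * B) ^ (p - 1) * (D.κ ^ (1 / 2 : ℝ) * B)) * (B * D.μ ^ (-(2 / p))) ^ p) ^ (1 / p)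

include hB hB1

omit hA hB1 in
/-- The `L^p` bounds of the blocks. [folklore] -/
theorem eLpNorm_blocks_le (x : Idx) (t : ℝ) {p : ℝ} (hp1 : 1 ≤ p) (hp2 : p ≤ 2) (l : Fin 3) :
    eLpNorm (fun z => Jet.eta (D.J x) x t z * Torus.partialDeriv l (Jet.phiJ (D.J x) D.s x) z) (ENNReal.ofReal p) volume ≤ ENNReal.ofReal (D.Keta B p) ∧
    eLpNorm (fun z => Jet.etaD (D.J x) x t z * Torus.partialDeriv l (Jet.phiJ (D.J x) D.s x) z) (ENNReal.ofReal p) volume ≤ ENNReal.ofReal (D.KetaD B p) := by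
  have hηc : Continuous (Jet.eta (D.J x) x t) := (Jet.isSmooth_eta (Jvalid h x) x t).continuous
  have hη'c : Continuous (Jet.etaD (D.J x) x t) := (Jet.isSmooth_etaD (Jvalid h x) x t).continuous
  have hφc : Continuous (Torus.partialDeriv l (Jet.phiJ (D.J x) D.s x)) := ((isSmooth_phiJ h x).partialDeriv l).continuous
  have I1 := (hB x t).int_rpow_eta_dphi p hp1 hp2 l
  have I2 := (hB x t).int_rpow_etaD_dphi p hp1 hp2 l
  exact ⟨eLpNorm_le_of_integral_rpow_le (hηc.mul hφc) hp1 I1, eLpNorm_le_of_integral_rpow_le (hη'c.mul hφc) hp1 I2⟩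

omit hA hB hB1 in
/-- Nonnegativity of `Keta`, `KetaD`. [folklore] -/
theorem Keta_nonneg (p : ℝ) (hB0 : 0 ≤ B) : 0 ≤ D.Keta B p ∧ 0 ≤ D.KetaD B p := by
  obtain ⟨hμ, hκ, hσ, hmup, -⟩ := pos h
  unfold Keta KetaD
  constructor <;> positivity

/-- **`‖∂ₜ(aΩ_x) eₘ‖_{L^p} ≤ 3(6A₁ K_η + 30σμ′A₀ K_{η′})`**. [cite: BuckmasterVicol2020, §7.6.2 (7.49)] -/
theorem eLpNorm_Adot_apply_le (x : Idx) {t : ℝ} (ht : t ∈ Icc 0 D.T) {p : ℝ} (hp1 : 1 ≤ p) (hp2 : p ≤ 2) (m : Fin 3) :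
    eLpNorm (fun z => D.Adot x t z m) (ENNReal.ofReal p) volume ≤
      ENNReal.ofReal (3 * (6 * A₁ * D.Keta B p + 30 * D.σ * D.mup * A₀ * D.KetaD B p)) := by
  obtain ⟨hμ, hκ, hσ, hmup, -⟩ := pos h
  have hA0 := hA.hA₀; have hA1 := hA.hA₁
  have hB0 : 0 ≤ B := by linarith
  obtain ⟨hK1, hK2⟩ := Keta_nonneg h p hB0
  have hηc : Continuous (Jet.eta (D.J x) x t) := (Jet.isSmooth_eta (Jvalid h x) x t).continuous
  have hη'c : Continuous (Jet.etaD (D.J x) x t) := (Jet.isSmooth_etaD (Jvalid h x) x t).continuous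
  have hφc : ∀ l, Continuous (Torus.partialDeriv l (Jet.phiJ (D.J x) D.s x)) := fun l => ((isSmooth_phiJ h x).partialDeriv l).continuous
  -- index the six blocks by `Fin 3 ⊕ Fin 3`
  set c : Fin 3 ⊕ Fin 3 → ℝ := Sum.elim (fun _ => 6 * A₁) (fun _ => 30 * D.σ * D.mup * A₀) with hc
  set K : Fin 3 ⊕ Fin 3 → ℝ := Sum.elim (fun _ => D.Keta B p) (fun _ => D.KetaD B p) with hK
  set mm : Fin 3 ⊕ Fin 3 → 𝕋³ → ℝ := Sum.elim (fun l z => Jet.eta (D.J x) x t z * Torus.partialDeriv l (Jet.phiJ (D.J x) D.s x) z)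
    (fun l z => Jet.etaD (D.J x) x t z * Torus.partialDeriv l (Jet.phiJ (D.J x) D.s x) z) with hmm
  have h1 : eLpNorm (fun z => D.Adot x t z m) (ENNReal.ofReal p) volume ≤ ENNReal.ofReal (∑ i ∈ Finset.univ, c i * K i) := by
    refine Torus.eLpNorm_le_of_norm_le_sum (m := mm) Finset.univ (fun i _ => ?_) (fun i _ => ?_) (fun i _ => ?_) (fun i _ => ?_) (fun z => ?_)
      (by simpa using hp1)
    · rcases i with l | l <;> simp only [hc, Sum.elim_inl, Sum.elim_inr] <;> positivity
    · rcases i with l | l <;> simp only [hK, Sum.elim_inl, Sum.elim_inr]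
      · exact hK1
      · exact hK2
    · rcases i with l | l <;> simp only [hmm, Sum.elim_inl, Sum.elim_inr]
      · exact (hηc.mul (hφc l)).aestronglyMeasurable
      · exact (hη'c.mul (hφc l)).aestronglyMeasurable
    · rcases i with l | l <;> simp only [hmm, hK, Sum.elim_inl, Sum.elim_inr]
      · exact (eLpNorm_blocks_le h hB x t hp1 hp2 l).1
      · exact (eLpNorm_blocks_le h hB x t hp1 hp2 l).2
    · rw [Fintype.sum_sum_type]
      simp only [hc, hmm, Sum.elim_inl, Sum.elim_inr]
      rw [← Finset.sum_add_distrib]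
      exact norm_Adot_apply_le h hA x ht z m
  refine h1.trans (le_of_eq ?_)
  congr 1
  rw [Fintype.sum_sum_type]
  simp only [hc, hK, Sum.elim_inl, Sum.elim_inr, Finset.sum_const, Finset.card_univ, Fintype.card_fin, nsmul_eq_mul, Nat.cast_ofNat]
  ring

/-- **`‖ℛ f₁‖_{L^p} ≤ 9 N C_ℛ (6A₁K_η + 30σμ′A₀K_{η′})`** and hence the same bound for `∫‖ℛ f₁‖`
(`1 < p ≤ 2`; `C_ℛ` the constant of `‖ℛ div A‖_p ≤ C_ℛ ∑ₘ‖Aeₘ‖_p`). [cite: BuckmasterVicol2020, §7.6.2 (7.49)] -/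
theorem integral_norm_antidivergence_f₁_le {p : ℝ} (hp1 : 1 ≤ p) (hp2 : p ≤ 2) {Cℛ : ℝ≥0}
    (hCℛ : ∀ A : 𝕋³ → Fin 3 → E³, Torus.IsSmooth A → eLpNorm (Torus.antidivergence (Torus.tensorDivergence A)) (ENNReal.ofReal p) volume ≤
      Cℛ * ∑ m, eLpNorm (fun y => A y m) (ENNReal.ofReal p) volume)
    {t : ℝ} (ht : t ∈ Icc 0 D.T) :
    eLpNorm (Torus.antidivergence (D.f₁ t)) (ENNReal.ofReal p) volume ≤
      ENNReal.ofReal (NN * ((Cℛ : ℝ) * (3 * (3 * (6 * A₁ * D.Keta B p + 30 * D.σ * D.mup * A₀ * D.KetaD B p))))) ∧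
    ∫ y, ‖Torus.antidivergence (D.f₁ t) y‖ ≤ NN * ((Cℛ : ℝ) * (3 * (3 * (6 * A₁ * D.Keta B p + 30 * D.σ * D.mup * A₀ * D.KetaD B p)))) := by
  obtain ⟨hμ, hκ, hσ, hmup, -⟩ := pos h
  have hA0 := hA.hA₀; have hA1 := hA.hA₁
  have hB0 : 0 ≤ B := by linarith
  obtain ⟨hK1, hK2⟩ := Keta_nonneg h p hB0
  set Q : ℝ := 3 * (6 * A₁ * D.Keta B p + 30 * D.σ * D.mup * A₀ * D.KetaD B p) with hQ
  have hQ0 : 0 ≤ Q := by rw [hQ]; positivity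
  have hAd : ∀ x, Torus.IsSmooth (D.Adot x t) := fun x => isSmooth_Adot h x ht
  have hdiv : ∀ x, Torus.IsSmooth (Torus.tensorDivergence (D.Adot x t)) := fun x => (hAd x).tensorDivergence
  -- each direction
  have hx : ∀ x, eLpNorm (Torus.antidivergence (Torus.tensorDivergence (D.Adot x t))) (ENNReal.ofReal p) volume ≤ ENNReal.ofReal ((Cℛ : ℝ) * (3 * Q)) := by
    intro x
    refine (hCℛ _ (hAd x)).trans ?_
    calc (Cℛ : ℝ≥0∞) * ∑ m, eLpNorm (fun y => D.Adot x t y m) (ENNReal.ofReal p) volume ≤ (Cℛ : ℝ≥0∞) * ∑ _m : Fin 3, ENNReal.ofReal Q :=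
          mul_le_mul_right (Finset.sum_le_sum fun m _ => eLpNorm_Adot_apply_le h hA hB hB1 x ht hp1 hp2 m) _
      _ = ENNReal.ofReal ((Cℛ : ℝ) * (3 * Q)) := by
          rw [Finset.sum_const, Finset.card_univ, Fintype.card_fin, nsmul_eq_mul, Nat.cast_ofNat, ← ENNReal.ofReal_ofNat 3,
            ← ENNReal.ofReal_mul (by norm_num), ENNReal.ofReal_mul Cℛ.coe_nonneg, ENNReal.ofReal_coe_nnreal]
  -- the sum over directions
  have ef : D.f₁ t = fun y => ∑ x ∈ Finset.univ, Torus.tensorDivergence (D.Adot x t) y := funext fun y => f₁_eq_sum_tensorDivergence_Adot h ht y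
  have eR : Torus.antidivergence (D.f₁ t) = fun y => ∑ x ∈ Finset.univ, Torus.antidivergence (Torus.tensorDivergence (D.Adot x t)) y := by
    rw [ef, show (fun y => ∑ x ∈ Finset.univ, Torus.tensorDivergence (D.Adot x t) y) = ∑ x ∈ Finset.univ, Torus.tensorDivergence (D.Adot x t) from by
      funext y; simp [Finset.sum_apply], Torus.antidivergence_finset_sum _ (fun x _ => hdiv x)]
    funext y; simp [Finset.sum_apply]
  have hLp : eLpNorm (Torus.antidivergence (D.f₁ t)) (ENNReal.ofReal p) volume ≤ ENNReal.ofReal (NN * ((Cℛ : ℝ) * (3 * Q))) := by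
    rw [eR]
    have hp1' : 1 ≤ ENNReal.ofReal p := by simpa using hp1
    calc eLpNorm (fun y => ∑ x ∈ Finset.univ, Torus.antidivergence (Torus.tensorDivergence (D.Adot x t)) y) (ENNReal.ofReal p) volume
        ≤ ∑ x ∈ Finset.univ, eLpNorm (Torus.antidivergence (Torus.tensorDivergence (D.Adot x t))) (ENNReal.ofReal p) volume := by
          have := eLpNorm_sum_le (s := (Finset.univ : Finset Idx)) (μ := (volume : Measure 𝕋³)) (p := ENNReal.ofReal p)
            (f := fun x => Torus.antidivergence (Torus.tensorDivergence (D.Adot x t)))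
            (fun x _ => (Torus.isSmooth_antidivergence (hdiv x)).continuous.aestronglyMeasurable) hp1'
          rwa [show (∑ x ∈ Finset.univ, Torus.antidivergence (Torus.tensorDivergence (D.Adot x t))) =
            fun y => ∑ x ∈ Finset.univ, Torus.antidivergence (Torus.tensorDivergence (D.Adot x t)) y from by funext y; simp [Finset.sum_apply]] at this
      _ ≤ ∑ _x : Idx, ENNReal.ofReal ((Cℛ : ℝ) * (3 * Q)) := Finset.sum_le_sum fun x _ => hx x
      _ = ENNReal.ofReal (NN * ((Cℛ : ℝ) * (3 * Q))) := by
          rw [Finset.sum_const, Finset.card_univ, nsmul_eq_mul, NN, ← ENNReal.ofReal_natCast, ← ENNReal.ofReal_mul (Nat.cast_nonneg _)]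
  refine ⟨hLp, ?_⟩
  -- `L¹ ≤ L^p` on the probability space
  have h1 : eLpNorm (Torus.antidivergence (D.f₁ t)) 1 volume ≤ eLpNorm (Torus.antidivergence (D.f₁ t)) (ENNReal.ofReal p) volume :=
    eLpNorm_le_eLpNorm_of_exponent_le (by simpa using hp1)
      (Torus.isSmooth_antidivergence ((smooth_f₁ h).isSmooth_slice ht)).continuous.aestronglyMeasurable
  exact integral_norm_le_of_eLpNorm_one_le (Torus.isSmooth_antidivergence ((smooth_f₁ h).isSmooth_slice ht)).continuous
    (by have := one_le_NN; positivity) (h1.trans hLp)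

end Datum

end JetStep

end Literature.Analysis.FluidPDE
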